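import Summits.HodgeConjecture.HodgeCM.PerL34.CompactDomain_1

/-! PORT of `HodgeCM/PerL34/CompactDomain.lean` (HodgeCMPerL run 81) — part 2: continuation of `Summits.HodgeConjecture.HodgeCM.PerL34.CompactDomain_1` (split at a top-level declaration boundary by port_pkg.py; scope re-opened below; declarations unchanged). -/

-- port_pkg: scope re-opened for this part (file-level context, then the namespace/section stack open at the cut)
set_option autoImplicit false
noncomputable section
open MeasureTheory Set Topology Filter Function
open scoped Pointwise ENNReal
namespace HodgeCM.PerL34.DiscreteFD
section Group
variable {G : Type*} [Group G] [TopologicalSpace G] [IsTopologicalGroup G] [LocallyCompactSpace G]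
  [T2Space G] [MeasurableSpace G] [BorelSpace G]
/-- **Compact fundamental domain, LEFT action, `Γ` normal (e.g. `G` commutative).**  For a discrete,
countable, cocompact normal subgroup `Γ` and a measure `μ` finite on compact sets and left and right
invariant, there is a COMPACT set `𝓕` with NON-EMPTY INTERIOR which is a fundamental domain of the left
action of `Γ` (`IsFundamentalDomain Γ 𝓕 μ`); moreover `𝓕` is the closure of an exact measurable
fundamental domain `𝓕₀` and `μ (𝓕 \ 𝓕₀) = 0`. -/
theorem exists_compact_isFundamentalDomain_left (Γ : Subgroup G) [DiscreteTopology Γ] [Countable Γ]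
    [Γ.Normal] [CompactSpace (G ⧸ Γ)] (μ : Measure G) [IsFiniteMeasureOnCompacts μ]
    [μ.IsMulLeftInvariant] [μ.IsMulRightInvariant] :
    ∃ 𝓕 𝓕₀ : Set G, IsCompact 𝓕 ∧ IsClosed 𝓕 ∧ (interior 𝓕).Nonempty ∧ MeasurableSet 𝓕 ∧
      IsFundamentalDomain Γ 𝓕 μ ∧ MeasurableSet 𝓕₀ ∧ 𝓕₀ ⊆ 𝓕 ∧ 𝓕 = closure 𝓕₀ ∧
      μ (𝓕 \ 𝓕₀) = 0 ∧ ∀ x : G, ∃! γ : Γ, γ • x ∈ 𝓕₀ := by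
  classical
  obtain ⟨U, hU, hU1⟩ := exists_nhds_one_eq_one Γ
  obtain ⟨W, hWo, hW1, hWr, -, hWc, hWf⟩ := exists_good_nhds μ hU
  obtain ⟨t, ht⟩ := exists_finset_cover_left Γ hWo hW1
  set V : G → Set G := fun x => (fun w => w * x) '' W with hV
  set A : ℕ → Set G := localFamily t V with hA
  have hAo : ∀ n, IsOpen (A n) :=
    localFamily_induction t V isOpen_empty fun x _ => isOpenMap_mul_right x W hWo
  have hdisj : ∀ (n : ℕ) (γ : Γ), γ ≠ 1 → Disjoint (γ • A n) (A n) := fun n γ hγ =>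
    localFamily_induction t V (p := fun s => Disjoint (γ • s) s) (by simp)
      (fun x _ => disjoint_smul_translate_left hU1 hWr x γ hγ) n
  have hcov : ∀ y : G, ∃ (γ : Γ) (n : ℕ), γ • y ∈ A n := by
    intro y
    obtain ⟨γ, x, hx, hγ⟩ := ht y
    obtain ⟨n, hn⟩ := exists_localFamily_eq t V hx
    refine ⟨γ, n, ?_⟩
    show γ • y ∈ localFamily t V n
    rw [hn]
    exact hγ
  have hex : ∀ y : G, ∃! γ : Γ, γ • y ∈ dom Γ A := existsUnique_smul_mem_dom hdisj hcov
  have h𝓕₀m : MeasurableSet (dom Γ A) := measurableSet_dom fun n => (hAo n).measurableSet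
  -- the first local set is a non-empty open subset
  obtain ⟨γ₁, x₁, hx₁, -⟩ := ht 1
  have hcard : 0 < t.card := Finset.card_pos.2 ⟨x₁, hx₁⟩
  have hA0 : A 0 = V ((t.equivFin.symm ⟨0, hcard⟩ : ↥t) : G) := localFamily_of_lt t V hcard
  -- compactness of the closure
  have hsub : dom Γ A ⊆ ⋃ x ∈ t, (fun w => w * x) '' closure W :=
    (dom_subset (K := ⋃ x ∈ t, V x) (localFamily_subset t V)).trans
      (iUnion₂_mono fun x _ => image_mono subset_closure)
  have hcpt : IsCompact (closure (dom Γ A)) :=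
    (t.isCompact_biUnion fun x _ => hWc.image (continuous_id.mul continuous_const)).closure_of_subset
      hsub
  -- the boundary is null
  have hnull : μ (closure (dom Γ A) \ dom Γ A) = 0 := by
    refine measure_mono_null (closure_dom_diff_subset hAo fun n hn => localFamily_of_le t V hn)
      (measure_iUnion_null_iff.2 fun n => ?_)
    refine localFamily_induction t V (p := fun s => μ (frontier s) = 0) (by simp) (fun x _ => ?_) n
    show μ (frontier ((fun w => w * x) '' W)) = 0
    rw [show (fun w => w * x) = ⇑(Homeomorph.mulRight x) from rfl, ← Homeomorph.image_frontier,
      Homeomorph.coe_mulRight, image_mul_right, measure_preimage_mul_right]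
    exact hWf
  refine ⟨closure (dom Γ A), dom Γ A, hcpt, isClosed_closure, ?_, isClosed_closure.measurableSet,
    ?_, h𝓕₀m, subset_closure, rfl, hnull, hex⟩
  · refine ⟨(t.equivFin.symm ⟨0, hcard⟩ : ↥t), subset_interior_closure_dom (hAo 0) ?_⟩
    rw [hA0]
    exact ⟨1, hW1, one_mul _⟩
  · exact isFundamentalDomain_of_exact_of_null μ hex subset_closure
      isClosed_closure.measurableSet.nullMeasurableSet hnull

/-- **Compact fundamental domain, RIGHT action (`Γ.op`), any discrete countable cocompact `Γ`.** -/
theorem exists_compact_isFundamentalDomain_op (Γ : Subgroup G) [DiscreteTopology Γ] [Countable Γ]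
    [CompactSpace (G ⧸ Γ)] (μ : Measure G) [IsFiniteMeasureOnCompacts μ]
    [μ.IsMulLeftInvariant] [μ.IsMulRightInvariant] :
    ∃ 𝓕 𝓕₀ : Set G, IsCompact 𝓕 ∧ IsClosed 𝓕 ∧ (interior 𝓕).Nonempty ∧ MeasurableSet 𝓕 ∧
      IsFundamentalDomain Γ.op 𝓕 μ ∧ MeasurableSet 𝓕₀ ∧ 𝓕₀ ⊆ 𝓕 ∧ 𝓕 = closure 𝓕₀ ∧
      μ (𝓕 \ 𝓕₀) = 0 ∧ ∀ x : G, ∃! γ : Γ.op, γ • x ∈ 𝓕₀ := by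
  classical
  obtain ⟨U, hU, hU1⟩ := exists_nhds_one_eq_one Γ
  obtain ⟨W, hWo, hW1, -, hWl, hWc, hWf⟩ := exists_good_nhds μ hU
  obtain ⟨t, ht⟩ := exists_finset_cover_op Γ hWo hW1
  set V : G → Set G := fun x => (fun w => x * w) '' W with hV
  set A : ℕ → Set G := localFamily t V with hA
  have hAo : ∀ n, IsOpen (A n) :=
    localFamily_induction t V isOpen_empty fun x _ => isOpenMap_mul_left x W hWo
  have hdisj : ∀ (n : ℕ) (γ : Γ.op), γ ≠ 1 → Disjoint (γ • A n) (A n) := fun n γ hγ =>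
    localFamily_induction t V (p := fun s => Disjoint (γ • s) s) (by simp)
      (fun x _ => disjoint_smul_translate_op hU1 hWl x γ hγ) n
  have hcov : ∀ y : G, ∃ (γ : Γ.op) (n : ℕ), γ • y ∈ A n := by
    intro y
    obtain ⟨γ, x, hx, hγ⟩ := ht y
    obtain ⟨n, hn⟩ := exists_localFamily_eq t V hx
    refine ⟨γ, n, ?_⟩
    show γ • y ∈ localFamily t V n
    rw [hn]
    exact hγ
  have hex : ∀ y : G, ∃! γ : Γ.op, γ • y ∈ dom Γ.op A := existsUnique_smul_mem_dom hdisj hcov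
  have h𝓕₀m : MeasurableSet (dom Γ.op A) := measurableSet_dom fun n => (hAo n).measurableSet
  obtain ⟨γ₁, x₁, hx₁, -⟩ := ht 1
  have hcard : 0 < t.card := Finset.card_pos.2 ⟨x₁, hx₁⟩
  have hA0 : A 0 = V ((t.equivFin.symm ⟨0, hcard⟩ : ↥t) : G) := localFamily_of_lt t V hcard
  have hsub : dom Γ.op A ⊆ ⋃ x ∈ t, (fun w => x * w) '' closure W :=
    (dom_subset (K := ⋃ x ∈ t, V x) (localFamily_subset t V)).trans
      (iUnion₂_mono fun x _ => image_mono subset_closure)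
  have hcpt : IsCompact (closure (dom Γ.op A)) :=
    (t.isCompact_biUnion fun x _ => hWc.image (continuous_const.mul continuous_id)).closure_of_subset
      hsub
  have hnull : μ (closure (dom Γ.op A) \ dom Γ.op A) = 0 := by
    refine measure_mono_null (closure_dom_diff_subset hAo fun n hn => localFamily_of_le t V hn)
      (measure_iUnion_null_iff.2 fun n => ?_)
    refine localFamily_induction t V (p := fun s => μ (frontier s) = 0) (by simp) (fun x _ => ?_) n
    show μ (frontier ((fun w => x * w) '' W)) = 0
    rw [show (fun w => x * w) = ⇑(Homeomorph.mulLeft x) from rfl, ← Homeomorph.image_frontier,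
      Homeomorph.coe_mulLeft, image_mul_left, measure_preimage_mul]
    exact hWf
  refine ⟨closure (dom Γ.op A), dom Γ.op A, hcpt, isClosed_closure, ?_,
    isClosed_closure.measurableSet, ?_, h𝓕₀m, subset_closure, rfl, hnull, hex⟩
  · refine ⟨(t.equivFin.symm ⟨0, hcard⟩ : ↥t), subset_interior_closure_dom (hAo 0) ?_⟩
    rw [hA0]
    exact ⟨1, hW1, mul_one _⟩
  · exact isFundamentalDomain_of_exact_of_null μ hex subset_closure
      isClosed_closure.measurableSet.nullMeasurableSet hnull

/-- Short form, left action. -/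
theorem exists_compact_isFundamentalDomain_left' (Γ : Subgroup G) [DiscreteTopology Γ]
    [Countable Γ] [Γ.Normal] [CompactSpace (G ⧸ Γ)] (μ : Measure G) [IsFiniteMeasureOnCompacts μ]
    [μ.IsMulLeftInvariant] [μ.IsMulRightInvariant] :
    ∃ 𝓕 : Set G, IsCompact 𝓕 ∧ (interior 𝓕).Nonempty ∧ MeasurableSet 𝓕 ∧
      IsFundamentalDomain Γ 𝓕 μ := by
  obtain ⟨𝓕, -, h1, -, h2, h3, h4, -⟩ := exists_compact_isFundamentalDomain_left Γ μ
  exact ⟨𝓕, h1, h2, h3, h4⟩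

/-- Short form, right action. -/
theorem exists_compact_isFundamentalDomain_op' (Γ : Subgroup G) [DiscreteTopology Γ]
    [Countable Γ] [CompactSpace (G ⧸ Γ)] (μ : Measure G) [IsFiniteMeasureOnCompacts μ]
    [μ.IsMulLeftInvariant] [μ.IsMulRightInvariant] :
    ∃ 𝓕 : Set G, IsCompact 𝓕 ∧ (interior 𝓕).Nonempty ∧ MeasurableSet 𝓕 ∧
      IsFundamentalDomain Γ.op 𝓕 μ := by
  obtain ⟨𝓕, -, h1, -, h2, h3, h4, -⟩ := exists_compact_isFundamentalDomain_op Γ μ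
  exact ⟨𝓕, h1, h2, h3, h4⟩

omit [LocallyCompactSpace G] [T2Space G] [IsTopologicalGroup G] [BorelSpace G] in
/-- On a commutative group a left invariant measure is right invariant. -/
theorem isMulRightInvariant_of_comm {G : Type*} [CommGroup G] [MeasurableSpace G] (μ : Measure G)
    [μ.IsMulLeftInvariant] : μ.IsMulRightInvariant := by
  constructor
  intro g
  have : (fun x : G => x * g) = fun x => g * x := funext fun x => mul_comm x g
  rw [this]
  exact map_mul_left_eq_self μ g

end Group

end HodgeCM.PerL34.DiscreteFD

end
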